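import Literature.Geometry.Kaehler.HolomorphicChainCroftonJensen
import HarnessLib

/-!
# The sign of `θ(v, iv, ξ_T)` on the carrier of a hypersurface chain

Layer `Literature/Geometry/Kaehler`; lane `lit-hodgefound`, prover seat `lit-hodgefound-p07`,
generation 19 — rider of the Crofton–Jensen inequality (`HolomorphicChainCroftonJensen.lean`)
towards FILE C (torus glue) of the programme «`[Θ_Ω] = -E_Ω` for every `Ω ∈ 𝔥_g`»: for a
holomorphic `p`-chain `T` on `Ω ⊆ V`, `dim V = p + 1`, a vector `v` with unitary basis `bW` of
`W = (ℂ v)^⊥`, and a real `(2 + 2p)`-form `θ` with `θ(v, iv, e_W) ≥ 0`, the density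
`x ↦ θ(v, iv, ξ_T(x))` of the Crofton–Jensen inequality is NON-NEGATIVE at every point of the carrier
(`HolomorphicChain.apply_append_orientationFrame_nonneg`): at tangential points it vanishes
(`apply_append_orientationFrame_eq_zero_of_mem_approxTangentCone`), at transversal points the Crofton
slice identity `J · θ(v, iv, ξ_T) = θ(v, iv, e_W)` of `HolomorphicChainTransversalGraphChart.lean`
holds with `J > 0`. Consequently the `ENNReal.ofReal` in the Crofton–Jensen inequality truncates
nothing, and the inequality can be read on Bochner integrals (FILE C).

Theorems only; no definitions, no named facts.

## References

* [Chirka1989] E. M. Chirka, *Complex Analytic Sets*, Kluwer (1989), §14.1 (canonical orientation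
  of `reg A`: `∫_A φ ≥ 0` for positive forms), §16.3 Thm. 1.
-/

noncomputable section

open scoped Manifold Topology
open Set Filter MeasureTheory Metric Function Module

namespace Literature.Geometry.Kaehler

namespace HolomorphicChain

open Literature.Geometry.GeometricMeasureTheory

-- Nested operator-norm instances on `Covector V m`, as in `Currents.lean`.
set_option maxSynthPendingDepth 2

variable {V : Type*} [NormedAddCommGroup V] [InnerProductSpace ℂ V] [FiniteDimensional ℂ V]
  [MeasurableSpace V] [BorelSpace V] {Ω : TopologicalSpace.Opens V} {p : ℕ}

/-- **`θ(v, iv, ξ_T) ≥ 0` on the carrier when `θ(v, iv, e_W) ≥ 0`** (hypersurface chain,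
`dim V = p + 1`): zero at tangential points, and `θ(v, iv, e_W) / J` with `J > 0` the Jacobian of a
graph chart at transversal points. [cite: Chirka1989, §14.1 and §16.3 Thm. 1 (proof, p. 216)] -/
theorem apply_append_orientationFrame_nonneg (hV : finrank ℂ V = p + 1)
    (T : HolomorphicChain 𝓘(ℂ, V) Ω p) {x v : V} (hx : x ∈ T.carrier)
    (bW : OrthonormalBasis (Fin p) ℂ (ℂ ∙ v)ᗮ) (θ : V [⋀^Fin (2 + 2 * p)]→L[ℝ] ℝ)
    (hθ : 0 ≤ θ (Fin.append ![v, Complex.I • v] (complexFrame fun j => (bW j : V)))) :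
    0 ≤ θ (Fin.append ![v, Complex.I • v] (T.orientationFrame x)) := by
  by_cases hvx : v ∈ approxTangentCone (2 * p) ((μHE[2 * p] : Measure V).restrict T.carrier) x
  · rw [T.apply_append_orientationFrame_eq_zero_of_mem_approxTangentCone hx hvx θ]
  -- transversal point: graph chart with `Γ 0 = x`
  letI iW : InnerProductSpace ℝ (ℂ ∙ v)ᗮ := InnerProductSpace.complexToReal
  letI iV : InnerProductSpace ℝ V := InnerProductSpace.complexToReal
  obtain ⟨N, g, ρ, Γ, hNo, -, -, -, hg, hgZ, hsurj, hrank, hWp, hρ, hΓ, hΓ0, himage, hπ⟩ :=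
    T.exists_graphChart_of_notMem_approxTangentCone hV hx hvx univ_mem
  have h0 : (0 : (ℂ ∙ v)ᗮ) ∈ ball (0 : (ℂ ∙ v)ᗮ) ρ := mem_ball_self hρ
  have hid := T.normDet_mul_apply_append_orientationFrame_eq hNo hg hgZ hsurj hrank hWp hΓ himage
    hπ bW θ h0
  rw [hΓ0] at hid
  -- the Jacobian is positive: `DΓ(0)` is injective
  set J : ℝ := (((fderiv ℂ Γ 0).restrictScalars ℝ : (ℂ ∙ v)ᗮ →L[ℝ] V) :
    (ℂ ∙ v)ᗮ →ₗ[ℝ] V).normDet with hJ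
  have himN : ∀ k ∈ ball (0 : (ℂ ∙ v)ᗮ) ρ, Γ k ∈ N := fun k hk =>
    (himage ▸ mem_image_of_mem Γ hk : Γ k ∈ ((↑) : Ω → V) '' T.support ∩ N).2
  have hg0 : ∀ k ∈ ball (0 : (ℂ ∙ v)ᗮ) ρ, g (Γ k) = 0 := fun k hk =>
    (hgZ _ (himN k hk)).1 (himage ▸ mem_image_of_mem Γ hk : Γ k ∈ ((↑) : Ω → V) '' T.support ∩ N).1
  have hinj : Function.Injective (((fderiv ℂ Γ 0).restrictScalars ℝ : (ℂ ∙ v)ᗮ →L[ℝ] V) :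
      (ℂ ∙ v)ᗮ →ₗ[ℝ] V) := by
    intro a b hab
    have hab' : fderiv ℂ Γ 0 a = fderiv ℂ Γ 0 b := hab
    have hmem : fderiv ℂ Γ 0 a - (a : V) - (fderiv ℂ Γ 0 b - (b : V)) ∈ ℂ ∙ v :=
      sub_mem (fderiv_graphChart_apply_sub_mem hNo hg hsurj hrank hΓ himN hg0 hπ h0 a)
        (fderiv_graphChart_apply_sub_mem hNo hg hsurj hrank hΓ himN hg0 hπ h0 b)
    rw [hab', sub_sub_sub_cancel_left, ← Submodule.coe_sub] at hmem
    have hW : ((b - a : (ℂ ∙ v)ᗮ) : V) ∈ (ℂ ∙ v)ᗮ := (b - a).2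
    have h0' : ((b - a : (ℂ ∙ v)ᗮ) : V) = 0 := by
      have := Submodule.inner_right_of_mem_orthogonal hmem hW
      rwa [inner_self_eq_zero] at this
    have : b - a = 0 := by exact_mod_cast h0'
    exact (sub_eq_zero.1 this).symm
  have hJ0 : J ≠ 0 := by
    rw [hJ, Ne, LinearMap.normDet_eq_zero_iff_ker_ne_bot, not_not]
    exact LinearMap.ker_eq_bot.2 hinj
  have hJpos : 0 < J := lt_of_le_of_ne (LinearMap.normDet_nonneg _) (Ne.symm hJ0)
  -- `J · θ(ξ) = c ≥ 0`
  have hprod : 0 ≤ J * θ (Fin.append ![v, Complex.I • v] (T.orientationFrame x)) := by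
    rw [hJ, hid]; exact hθ
  exact (mul_nonneg_iff_of_pos_left hJpos).1 hprod

end HolomorphicChain

end Literature.Geometry.Kaehler
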